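import Literature.Probability.Percolation.ArmSeparationNonvacuity
import HarnessLib

/-!
# Arms landed on the outer boundary only: the input events of the internal separation step

Topic: Probability / Percolation; family `crit-perc`. A brick of the discharge of
`Literature.Probability.Percolation.Nolin2008_twoArm_separation` (Nolin 2008, Thm. 11
[arXiv 0711.4948: Thm. 10], `j = 2`, `σ = BW`; `ArmSeparation.lean`). In the proof (§4.4) the
external extremities are separated first, producing arms that are well-separated and LANDED on
`∂Λ_N` (the events `Ã̃^{·/η'₀, I_{η'₀}}(2^{k+i}, 2^K)` of p. 13); the internal step is then run on
these events, "from `∂S_{2^k}` toward the interior". This file introduces their Lean form, the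
outer half of the landed event `sepOpenArm` of `ArmSeparation.lean`:

* `extOpenArm n N` — **an open arm from `∂Λ_n` landed on the right side of `∂Λ_N`**: a landing
  site `z ∈ sepLanding N`, the outer free space `sepOuterFence N z` crossed vertically by open sites
  through a site `u'`, and an open path from a site of norm `n` to `u'` inside the annulus
  `{n ≤ |v| ≤ N}` together with the outer attaching ball `S̊_{N/8}(z)`;
  `extTwoArm n N = extOpenArm n N ∩ negFlip ⁻¹' extOpenArm n N` (closed arm landed on the left);
* monotonicity (`isUpperSet_extOpenArm`), locality (`determinedBy_extOpenArm`: the sites of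
  `extSupportSet n N = {n ≤ |v| ≤ N + N/8, (N < |v| → 0 < v₀)}`), monotonicity in the inner radius
  (`extOpenArm_mono`: a longer arm contains a shorter one, by the last visit to `Λ_{n'}`),
  `sepOpenArm ⊆ extOpenArm`;
* `exists_closed_path_of_negFlip_mem_extOpenArm` — the closed arm of `negFlip ω ∈ extOpenArm n N`
  as a closed path of `ω` inside the reflected region, from a site of norm `n` to the reflected
  outer attaching site (the input format of `ArmSeparationInnerFrames.lean`).

## References

* P. Nolin, *Near-critical percolation in two dimensions*, Electron. J. Probab. 13 (2008), §4.2
  (Def. 6–8), §4.4 (proof of Thm. 11) [arXiv 0711.4948: Thm. 10, p. 13]. [Nolin2008]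

Tree: `sepLanding`, `sepOuterFence`, `OpenVCrossThrough`, `triAnnulusSet`, `triOpenBall`, `negFlip`,
`sepOpenArm` (`ArmSeparation.lean`); `isUpperSet_sepOpenArm` pattern, `negFlip` lemmas
(`ArmSeparationProofs.lean`, `ArmSeparationGlue.lean`); `PathIn.last_exit`, `pathIn_map_iso`,
`triNegIso`, `triNorm_neg`.
-/

noncomputable section

open Set

namespace Literature.Probability.Percolation

open LatticeModels

/-! ### The events -/

/-- **An open arm from `∂Λ_n` landed on the right side of `∂Λ_N`** (the outer half of
`sepOpenArm n N`: Nolin's arms well-separated and landed on the external boundary only, the events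
`Ã̃^{·/η'₀,I}` of §4.4): a landing site `z ∈ sepLanding N`, the outer free space crossed vertically
by open sites through `u'`, and an open path of `{n ≤ |v| ≤ N} ∪ S̊_{N/8}(z)` from a site `a` of
norm `n` to `u'`. [cite: Nolin2008, §4.2 Def. 6–8 and §4.4 (arXiv 0711.4948: proof of Thm. 10, p. 13)] -/
def extOpenArm (n N : ℕ) : Set (SiteConfig (Site 2)) :=
  {ω | ∃ z u' a : Site 2, z ∈ sepLanding N ∧ triNorm a = n ∧
    OpenVCrossThrough (sepOuterFence N z) (z 1 - (N / 64 : ℕ)) (z 1 + (N / 64 : ℕ)) ω u' ∧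
    PathIn triGraph ((triAnnulusSet n N ∪ triOpenBall z (N / 8)) ∩ ω) a u'}

/-- **Two arms landed on the outer boundary**: an open arm landed on the right side of `∂Λ_N` and
a closed arm landed on its left side (via `negFlip`). [cite: Nolin2008, §4.2 Def. 6–8 and §4.4 (arXiv 0711.4948: proof of Thm. 10, p. 13)] -/
def extTwoArm (n N : ℕ) : Set (SiteConfig (Site 2)) := extOpenArm n N ∩ negFlip ⁻¹' extOpenArm n N

/-- `extOpenArm` is increasing. [folklore] -/
theorem isUpperSet_extOpenArm (n N : ℕ) : IsUpperSet (extOpenArm n N) := by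
  rintro ω ω' hle ⟨z, u', a, hz, ha, ⟨b, t, hb, ht, p₁, p₂⟩, p⟩
  exact ⟨z, u', a, hz, ha, ⟨b, t, hb, ht, p₁.mono fun v hv => ⟨hv.1, hle hv.2⟩, p₂.mono fun v hv => ⟨hv.1, hle hv.2⟩⟩,
    p.mono fun v hv => ⟨hv.1, hle hv.2⟩⟩

/-- The landed event is contained in the outer-landed one (`2n ≤ N`): follow the arm from its last
visit to `Λ_n` (after it, the inner attaching ball is met only in the annulus). [folklore] -/
theorem sepOpenArm_subset_extOpenArm {n N : ℕ} (hnN : 2 * n ≤ N) : sepOpenArm n N ⊆ extOpenArm n N := by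
  rintro ω ⟨z, z', u, u', hz, hz', ⟨b, t, -, -, -, p₂⟩, hOut, p⟩
  have huF : u ∈ sepInnerFence n z' := p₂.left_mem.1
  have hun : triNorm u ≤ n := triNorm_le_of_mem_sepInnerFence hz' huF
  have hu'N : (N : ℤ) < triNorm u' := by
    obtain ⟨b', t', -, -, q, -⟩ := hOut
    exact lt_triNorm_of_mem_sepOuterFence q.right_mem.1
  obtain ⟨q, r, hqC, hqA, hrC, hqr, hσ⟩ := p.last_exit (C := {v : Site 2 | triNorm v ≤ n}) hun (by
    simp only [Set.mem_setOf_eq, not_le]; exact lt_of_le_of_lt (by omega) hu'N)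
  simp only [Set.mem_setOf_eq, not_le] at hqC hrC
  have hqn : triNorm q = n := by
    have := triNorm_le_triNorm_add_one_of_adj hqr
    omega
  have hzL := hz'
  rw [mem_sepLanding] at hzL
  have hnN' : 2 * (n : ℤ) ≤ N := by exact_mod_cast hnN
  have hreg : ∀ v ∈ sepJoinRegion n N z z' ∩ ω, (n : ℤ) ≤ triNorm v →
      v ∈ (triAnnulusSet n N ∪ triOpenBall z (N / 8)) ∩ ω := by
    rintro v ⟨(hv | hv) | hv, hvω⟩ hn
    · exact ⟨Or.inl hv, hvω⟩
    · exact ⟨Or.inr hv, hvω⟩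
    · refine ⟨Or.inl ⟨hn, ?_⟩, hvω⟩
      rw [mem_triOpenBall, triNorm_lt_iff_lin] at hv
      simp only [Pi.sub_apply] at hv
      exact triNorm_le_iff_lin.2 (by omega)
  refine ⟨z, u', q, hz, hqn, hOut, ?_⟩
  exact (PathIn.of_adj (hreg q hqA hqn.ge) (hreg r hσ.left_mem.1 hrC.le) hqr).trans
    (hσ.mono fun v hv => hreg v hv.1 (by have := hv.2; simp only [Set.mem_setOf_eq, not_le] at this; exact this.le))

/-! ### Locality -/

/-- **The support of the outer-landed arm event**: `{n ≤ |v| ≤ N + N/8}`, the sites beyond `Λ_N`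
being in the right half-plane. [cite: Nolin2008, §4.2 Def. 6 (arXiv 0711.4948)] -/
def extSupportSet (n N : ℕ) : Set (Site 2) :=
  {v | (n : ℤ) ≤ triNorm v ∧ triNorm v ≤ (N : ℤ) + (N / 8 : ℕ) ∧ ((N : ℤ) < triNorm v → 0 < v 0)}

/-- Membership in `extSupportSet`, unfolded. [folklore] -/
@[simp] theorem mem_extSupportSet {n N : ℕ} {v : Site 2} :
    v ∈ extSupportSet n N ↔ (n : ℤ) ≤ triNorm v ∧ triNorm v ≤ (N : ℤ) + (N / 8 : ℕ) ∧ ((N : ℤ) < triNorm v → 0 < v 0) :=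
  Iff.rfl

/-- The outer free space lies in the support. [cite: Nolin2008, §4.2 Def. 6 (arXiv 0711.4948)] -/
theorem sepOuterFence_subset_extSupportSet {n N : ℕ} (hnN : n ≤ N) {z : Site 2} (hz : z ∈ sepLanding N) :
    sepOuterFence N z ⊆ extSupportSet n N := by
  intro v hv
  have h := sepOuterFence_subset_sepSupportSet hnN hz hv
  rw [mem_sepSupportSet] at h
  have hN := lt_triNorm_of_mem_sepOuterFence hv
  have hnN' : (n : ℤ) ≤ N := by exact_mod_cast hnN
  exact ⟨by omega, h.2.1, fun h' => h.2.2 (Or.inr h')⟩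

/-- The arm region lies in the support. [cite: Nolin2008, §4.2 Def. 6 (arXiv 0711.4948)] -/
theorem extRegion_subset_extSupportSet {n N : ℕ} (hnN : 2 * n ≤ N) {z : Site 2} (hz : z ∈ sepLanding N) :
    triAnnulusSet n N ∪ triOpenBall z (N / 8) ⊆ extSupportSet n N := by
  rw [mem_sepLanding] at hz
  have hnN' : 2 * (n : ℤ) ≤ N := by exact_mod_cast hnN
  rintro v (hv | hv)
  · rw [mem_triAnnulusSet] at hv
    exact ⟨hv.1, by omega, fun h => by omega⟩
  · rw [mem_triOpenBall, triNorm_lt_iff_lin] at hv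
    simp only [Pi.sub_apply] at hv
    refine ⟨le_triNorm_iff_lin.2 (Or.inl (by omega)), triNorm_le_iff_lin.2 (by omega), fun _ => by omega⟩

/-- The event only depends on the sites of its support: restricting the configuration to
`extSupportSet n N` does not change it (`n ≤ N`). [folklore] -/
theorem mem_extOpenArm_iff_inter {n N : ℕ} (hnN : 2 * n ≤ N) (ω : SiteConfig (Site 2)) :
    ω ∈ extOpenArm n N ↔ ω ∩ extSupportSet n N ∈ extOpenArm n N := by
  constructor
  · rintro ⟨z, u', a, hz, ha, ⟨b, t, hb, ht, p₁, p₂⟩, p⟩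
    have hO := sepOuterFence_subset_extSupportSet (n := n) (by omega) hz
    have hR := extRegion_subset_extSupportSet hnN hz
    exact ⟨z, u', a, hz, ha, ⟨b, t, hb, ht, (pathIn_inter_inter_of_subset hO).2 p₁, (pathIn_inter_inter_of_subset hO).2 p₂⟩,
      (pathIn_inter_inter_of_subset hR).2 p⟩
  · intro h
    exact isUpperSet_extOpenArm n N (show ω ∩ extSupportSet n N ≤ ω from inter_subset_left) h

/-- **Locality of the outer-landed arm**: `extOpenArm n N` is determined by `extSupportSet n N`
(`n ≤ N`). [folklore] -/
theorem determinedBy_extOpenArm {n N : ℕ} (hnN : 2 * n ≤ N) : DeterminedBy (extOpenArm n N) (extSupportSet n N) := by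
  rw [determinedBy_iff]
  intro ω ω' hω
  rw [mem_extOpenArm_iff_inter hnN ω, mem_extOpenArm_iff_inter hnN ω', hω]

/-- **Locality of the two-arm event**: `extTwoArm n N` is determined by the sites of norm in
`[n, N + N/8]` (`2n ≤ N`). [folklore] -/
theorem determinedBy_extTwoArm {n N : ℕ} (hnN : 2 * n ≤ N) :
    DeterminedBy (extTwoArm n N) {v : Site 2 | (n : ℤ) ≤ triNorm v ∧ triNorm v ≤ (N : ℤ) + (N / 8 : ℕ)} := by
  refine ((determinedBy_extOpenArm hnN).mono ?_).inter ((determinedBy_extOpenArm hnN).preimage_negFlip.mono ?_)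
  · exact fun v hv => ⟨hv.1, hv.2.1⟩
  · intro v hv
    rw [Set.mem_preimage, mem_extSupportSet, triNorm_neg] at hv
    exact ⟨hv.1, hv.2.1⟩

/-! ### Monotonicity in the inner radius -/

/-- **A longer arm contains a shorter one**: `extOpenArm n N ⊆ extOpenArm n' N` for `n ≤ n' ≤ N`
(follow the arm from its last visit to `Λ_{n'}`: the previous site has norm exactly `n'`). [folklore] -/
theorem extOpenArm_mono {n n' N : ℕ} (hnn' : n ≤ n') (hn'N : n' ≤ N) : extOpenArm n N ⊆ extOpenArm n' N := by
  rintro ω ⟨z, u', a, hz, ha, hOut, p⟩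
  have hu'N : (N : ℤ) < triNorm u' := by
    obtain ⟨b', t', -, -, q, -⟩ := hOut
    exact lt_triNorm_of_mem_sepOuterFence q.right_mem.1
  have han : triNorm a ≤ n' := by rw [ha]; exact_mod_cast hnn'
  obtain ⟨q, r, hqC, hqA, hrC, hqr, hσ⟩ := p.last_exit (C := {v : Site 2 | triNorm v ≤ n'}) han (by
    simp only [Set.mem_setOf_eq, not_le]; exact lt_of_le_of_lt (by exact_mod_cast hn'N) hu'N)
  simp only [Set.mem_setOf_eq, not_le] at hqC hrC
  have hqn : triNorm q = n' := by
    have := triNorm_le_triNorm_add_one_of_adj hqr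
    omega
  have hreg : ∀ v ∈ (triAnnulusSet n N ∪ triOpenBall z (N / 8)) ∩ ω, (n' : ℤ) ≤ triNorm v →
      v ∈ (triAnnulusSet n' N ∪ triOpenBall z (N / 8)) ∩ ω := by
    rintro v ⟨hv | hv, hvω⟩ hn
    · exact ⟨Or.inl ⟨hn, (mem_triAnnulusSet.1 hv).2⟩, hvω⟩
    · exact ⟨Or.inr hv, hvω⟩
  refine ⟨z, u', q, hz, hqn, hOut, ?_⟩
  exact (PathIn.of_adj (hreg q hqA hqn.ge) (hreg r hσ.left_mem.1 hrC.le) hqr).trans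
    (hσ.mono fun v hv => hreg v hv.1 (by have := hv.2; simp only [Set.mem_setOf_eq, not_le] at this; exact this.le))

/-- `extTwoArm` is monotone in the inner radius. [folklore] -/
theorem extTwoArm_mono {n n' N : ℕ} (hnn' : n ≤ n') (hn'N : n' ≤ N) : extTwoArm n N ⊆ extTwoArm n' N :=
  Set.inter_subset_inter (extOpenArm_mono hnn' hn'N) (Set.preimage_mono (extOpenArm_mono hnn' hn'N))

/-! ### The closed arm as a path of closed sites -/

/-- **The closed arm of `negFlip ω`**: if `negFlip ω ∈ extOpenArm n N` then in `ω` there are a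
landing site `z`, an attaching site `u'` with the outer free space of `negFlip ω` crossed through
`u'`, and a CLOSED path of `ω` inside the reflected region `-( {n ≤ |v| ≤ N} ∪ S̊_{N/8}(z) )`
from a site of norm `n` to `-u'`. [folklore] -/
theorem exists_closed_path_of_negFlip_mem_extOpenArm {n N : ℕ} {ω : SiteConfig (Site 2)} (h : negFlip ω ∈ extOpenArm n N) :
    ∃ z u' a : Site 2, z ∈ sepLanding N ∧ triNorm a = n ∧
      OpenVCrossThrough (sepOuterFence N z) (z 1 - (N / 64 : ℕ)) (z 1 + (N / 64 : ℕ)) (negFlip ω) u' ∧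
      PathIn triGraph ((Neg.neg ⁻¹' (triAnnulusSet n N ∪ triOpenBall z (N / 8))) ∩ ωᶜ) (-a) (-u') := by
  obtain ⟨z, u', a, hz, ha, hOut, p⟩ := h
  refine ⟨z, u', a, hz, ha, hOut, ?_⟩
  have q := pathIn_map_iso triNegIso p
  refine q.mono ?_
  rintro w ⟨v, ⟨hv, hvω⟩, rfl⟩
  simp only [triNegIso_apply]
  refine ⟨by simpa using hv, ?_⟩
  rw [mem_negFlip] at hvω
  exact hvω

end Literature.Probability.Percolation
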